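import Summits.QuantumFields.YangMills.Theorems.LuscherReductionDressedRitzPolyakovLiftPScalingPrep
import Summits.QuantumFields.YangMills.Theorems.FemtoTransferGapMultiplierIMS
import Summits.QuantumFields.YangMills.Theorems.LuscherReductionDressedRitzOfOperatorPlateau
import HarnessLib

/-!
# Route `LuscherReduction`, crux `DressedRitz` (stmt-QuantumFields-20205), line «polyakovlift» r6 (09c950a55cd7b1f3) — NEGATIVE lane:
# the F9-I vacuum package AT FIXED TRIAL RADIUS cannot deliver the orders it is booked for (off-support floors), and the residual-free identity that repairs it

Negative-side support lemmas of the standing disprover (seat `ym-cdisprove-20205-1`, GEN 7; work file `Cruxes/DressedRitz/Disproof.lean` §11, evidence memo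
`F9-HAZARD-g7.md`).  Nothing here asserts a route item; nothing here refutes one.  Context: the LEAD's S-PSCAL″ programme (WAVE-2-BRIEFS F6/F8/F9, tree
`…PolyakovLiftPScalingPrep` p556539, `…PolyakovLiftTransplantAE` p557164, `FemtoTransferGapMultiplierIMS` p555853) writes the one-site top eigenvector as
`e₀ = (Φ̂₀ − η)/a₀` with the vacuum trial state `Φ̂₀ = (χ_{2R}f₀)∘gnCoord μ` at the FIXED radius `2R` (`R ∈ [1/(8Λ),1/(4Λ)]` registered, `μ = Λ/(2L)`), books
`‖η‖² = O(Λ/L)`, `‖(λ₀−K)η‖ = O(Λ/L)λ₀` ("F9-I: Φ̂₀ Rayleigh bound + ONE(B) ⇒ a₀, ‖η‖, P(η), ‖(λ₀−K)η‖", the last via `residual_sq_le_phys`: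
`‖λ₀x − Kx‖² ≤ λ₀P(x)`, `P(x) := λ₀‖x‖² − ⟨x,Kx⟩`), and bounds the soft error `P((g∘p_L)η)` by `energy_mul_le_su2` + Cauchy–Schwarz on `l2 (g²η)(λ₀η − Kη)`.

* §1 ABSTRACT FLOORS (symmetric positive-semidefinite `ip`, `ip`-symmetric `K`, unit top eigenvector `e₀`, domination of `e₀^⊥` at `λ₁ ≤ λ₀`; `a := ip x e₀`,
  `η := x − a·e₀`; an "off-support probe" `z` with `ip x z = 0`, `ip z z ≤ ip e₀ z` — model `z = ρe₀`, `0 ≤ ρ ≤ 1`, `ρ` supported in `{x = 0}`, `m := ip e₀ z`):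
  `a²m ≤ ip η η` (`offSupport_floor`); `(λ₀ − λ₁)a²m ≤ P(x)` (`firstMoment_floor`); ★ `λ₀(λ₀−λ₁)(a²m)² ≤ (λ₀P(x))·ip η η` (`proxy_floor`: the SQUARE of the
  only majorant of `‖η‖·‖(λ₀−K)η‖` obtainable through `residual_sq_le` is bounded BELOW); and the order comparison: a floor `D√μ` beats an allowance `Cb·μ`
  for every `0 < μ < (D/Cb)²` (`sqrt_floor_exceeds_linear_allowance`, ★ `allowance_lt_proxyMajorant` in the gap calibration `γμλ₀ ≤ λ₀ − λ₁`).
* §2 PHYSICAL SUBSPACE of the `(ℤ/L)³` model (any `L`, any `β`; the one-site assembly is `L := 1`, `β := 2L³/Λ³`): `vacuumDefect_floor` (probe `z`),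
  ★ `vacuumDefect_floor_mul` (probe `ρ·e₀`), ★★ `vacuumEnergy_floor` `(λ₀ − λ₁)·a²⟨e₀,z⟩ ≤ λ₀‖x‖² − ⟨x,K_βx⟩`, ★ `vacuumProxy_floor`; and
  ★★ `energy_mul_vacuum_eq`: for the TRUE top eigenvector the product identity of p555853 has NO residual bracket —
  `λ₀‖g e₀‖² − ⟨g e₀, K_β(g e₀)⟩ = ½∫∫ e₀(U)K_β(U,V)e₀(V)(g U − g V)²` (ground-state / Dirichlet-form representation).

READING (cdisprove g7, (G7-c) in `Disproof.lean` §11).  With `ρ = (1 − radialCutoff(2√2R))∘gnCoord μ` (physical, `0 ≤ ρ ≤ 1`, zero on `supp Φ̂₀`, one on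
`‖y‖ ≥ 4R`), `m = ∫ρe₀² → τ₀(4R) := ∫_{‖y‖≥4R}f₀² > 0` as `L → ∞` at fixed `Λ` (crux ONE, closed: two-sided levels + gap put `e₀` within `O(μ^{1/2})` of ONE's own
normalised trial state at radius `1/(8μ)`; `f₀ > 0`), and `λ₀ − λ₁ ≥ μΔ₁λ₀` (ONE).  Hence at radius `2R`, for all large `L`: `‖η‖²/‖Φ̂₀‖² ≥ τ₀(4R)/2` (an
L-independent positive number — `‖η‖² = O(Λ/L)` is false), `P(Φ̂₀)/(λ₀‖Φ̂₀‖²) ≥ μΔ₁τ₀(4R)/2` (order `μ`, not `μ²`; the provable upper side F6a + ONE's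
`oneSiteAbsUpper_of_AL1` is `c₁μ² + 4μAe^{−2R}` — the quasimode tail of F6a's energy slot sits at first order in `μ` for every L-independent radius), and the
planned majorant of F8a's first term is `Θ(μ^{1/2})·λ₀‖Φ̂₀‖²` against the `Θ(μ)` allowance `(e^{2μCΛ} − 1)λ_{i+1}‖w‖²`: no `L0` exists ON THAT ROUTE.  Not a
defect of S-PSCAL″: the REPAIR is `energy_mul_vacuum_eq` — substitute `e₀ = (Φ̂₀ − η)/a₀` inside the Dirichlet form, where `η` costs `O(μ)·‖η‖/a₀` through the
defect-row bound of F8b/F8c only (Cauchy–Schwarz in `L²(K_β(Δg)²)`), and `‖η‖²/a₀² ≤ P(Φ̂₀)/((λ₀−λ₁)a₀²) = O(e^{−2R} + μ)` is small enough; the main term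
`½∫∫Φ̂₀KΦ̂₀(Δg)² = qform((g∘p_L)²Φ̂₀,Φ̂₀) − qform(Ψ_{i+1},Ψ_{i+1}) ≈ 2μ·N′8c·∫|∇(χ_Rf_{i+1}/f₀)|²f₀²` needs a two-sided `O(μ^{1+δ})` chart evaluation (the tree has
the lower side `qform_gnTrial_ge` only).  Alternatives: a growing vacuum radius `R₀(μ) ≥ log(A/μ)` (then p557164's echo-free product identity fails for
`L > (Λ/2A)e^{π/(√2Λ)}` and the echo pieces need their own Rayleigh lower bounds) or a direct `O(μ)` norm bound on `(λ₀ − K)Φ̂₀`.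
HONEST FRAMING: fixed-lattice linear algebra about one planned estimate inside the proof plan of ONE one-site stub of a child of the CONDITIONAL reduction route
R2b1; no stub is closed or refuted; nothing here bears on infinite volume, the continuum limit or the Clay mass gap.
References: Reed–Simon IV, Thm. XIII.1 [cite: ReedSimonIV1978, Thm. XIII.1]; T. Kato (1949) §1 [cite: Kato1949, §1]; M. Lüscher, NPB 219 (1983) 233, §3
[cite: Luscher1983, §3]; B. Simon, Ann. Phys. 146 (1983) 209, §3 [cite: SimonB1983DiscreteSpectrum, §3].
-/

set_option autoImplicit false

noncomputable section

open MeasureTheory Filter Topology Real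
open Literature.MathematicalPhysics.QuantumFieldTheory (GaugeConfig Site gaugeTransform)
open scoped BigOperators

namespace Summit.QuantumFields.YangMills.Theorems.FemtoTransferGap.PolyakovLift.Negative

open Summit.QuantumFields.YangMills.Theorems.FemtoTransferGap

/-! ## §1 Abstract floors: one symmetric PSD form `ip`, one `ip`-symmetric `K`, one unit top eigenvector `e₀`, one off-support probe `z` -/

section Abstract

variable {D : Type*} [AddCommGroup D] [Module ℝ D]

/-- **Off-support floor (algebra).**  `ip` symmetric positive semidefinite, `a := ip x e₀`, `η := x − a·e₀`; if `ip x z = 0` and `ip z z ≤ ip e₀ z`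
(model: `z = ρ·e₀`, `0 ≤ ρ ≤ 1`, `ρ` supported where `x` vanishes) then `a²·ip e₀ z ≤ ip η η`. [folklore] -/
theorem offSupport_floor (ip : D →ₗ[ℝ] D →ₗ[ℝ] ℝ) (hip : ∀ x y, ip x y = ip y x) (hip0 : ∀ y, 0 ≤ ip y y)
    (e₀ x z : D) (hxz : ip x z = 0) (hzz : ip z z ≤ ip e₀ z) :
    ip x e₀ ^ 2 * ip e₀ z ≤ ip (x - ip x e₀ • e₀) (x - ip x e₀ • e₀) := by
  have hηz : ip (x - ip x e₀ • e₀) z = -(ip x e₀ * ip e₀ z) := by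
    simp only [map_sub, map_smul, LinearMap.sub_apply, LinearMap.smul_apply, smul_eq_mul, hxz]; ring
  have hcs := LiftLeak.bilin_sq_le ip hip hip0 (x - ip x e₀ • e₀) z
  rw [hηz, neg_sq, mul_pow] at hcs
  have hN := hip0 (x - ip x e₀ • e₀)
  rcases le_or_gt (ip e₀ z) 0 with hm | hm
  · exact (mul_nonpos_iff.2 (Or.inl ⟨sq_nonneg _, hm⟩)).trans hN
  · have h1 : ip x e₀ ^ 2 * ip e₀ z * ip e₀ z ≤ ip (x - ip x e₀ • e₀) (x - ip x e₀ • e₀) * ip e₀ z := by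
      have h2 := mul_le_mul_of_nonneg_left hzz hN
      nlinarith [h2, hcs]
    exact le_of_mul_le_mul_right h1 hm

/-- **First-moment floor (algebra).**  In addition `K` `ip`-symmetric, `ip e₀ e₀ = 1`, `K e₀ = λ₀e₀`, domination `ip(y,Ky) ≤ λ₁ ip(y,y)` on `e₀^⊥` and
`λ₁ ≤ λ₀`: the energy deficit `P(x) = λ₀ ip(x,x) − ip(x,Kx)` is at least `(λ₀ − λ₁)·a²·ip e₀ z`. [cite: ReedSimonIV1978, Thm. XIII.1] -/
theorem firstMoment_floor (ip : D →ₗ[ℝ] D →ₗ[ℝ] ℝ) (hip : ∀ x y, ip x y = ip y x) (hip0 : ∀ y, 0 ≤ ip y y) (K : D →ₗ[ℝ] D)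
    (hK : ∀ x y, ip (K x) y = ip x (K y)) {e₀ : D} (hn : ip e₀ e₀ = 1) {l0 l1 : ℝ} (heig : K e₀ = l0 • e₀)
    (hdom : ∀ y, ip y e₀ = 0 → ip y (K y) ≤ l1 * ip y y) (hl : l1 ≤ l0) (x z : D) (hxz : ip x z = 0) (hzz : ip z z ≤ ip e₀ z) :
    (l0 - l1) * (ip x e₀ ^ 2 * ip e₀ z) ≤ l0 * ip x x - ip x (K x) := by
  obtain ⟨hηe, hnorm, hform⟩ := PScal.top_split ip hip K hK hn heig x
  have hη := hdom _ hηe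
  have hfl := offSupport_floor ip hip hip0 e₀ x z hxz hzz
  have hmul := mul_le_mul_of_nonneg_left hfl (sub_nonneg.2 hl)
  rw [hnorm, hform]
  linarith

/-- `0 ≤ ip e₀ z` and `0 ≤ a²·ip e₀ z` for an off-support probe. [folklore] -/
theorem probe_nonneg (ip : D →ₗ[ℝ] D →ₗ[ℝ] ℝ) (hip0 : ∀ y, 0 ≤ ip y y) (e₀ x z : D) (hzz : ip z z ≤ ip e₀ z) :
    0 ≤ ip e₀ z ∧ 0 ≤ ip x e₀ ^ 2 * ip e₀ z :=
  have h := (hip0 z).trans hzz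
  ⟨h, mul_nonneg (sq_nonneg _) h⟩

/-- ★ **Proxy floor (algebra).**  The majorant `‖η‖·√(λ₀P(x))` of `‖η‖·‖λ₀η − Kη‖` furnished by `residual_sq_le` satisfies
`λ₀(λ₀ − λ₁)·(a²·ip e₀ z)² ≤ (λ₀·P(x))·ip η η` (`λ₀ ≥ 0`). [cite: Kato1949, §1] -/
theorem proxy_floor (ip : D →ₗ[ℝ] D →ₗ[ℝ] ℝ) (hip : ∀ x y, ip x y = ip y x) (hip0 : ∀ y, 0 ≤ ip y y) (K : D →ₗ[ℝ] D)
    (hK : ∀ x y, ip (K x) y = ip x (K y)) {e₀ : D} (hn : ip e₀ e₀ = 1) {l0 l1 : ℝ} (hl0 : 0 ≤ l0) (heig : K e₀ = l0 • e₀)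
    (hdom : ∀ y, ip y e₀ = 0 → ip y (K y) ≤ l1 * ip y y) (hl : l1 ≤ l0) (x z : D) (hxz : ip x z = 0) (hzz : ip z z ≤ ip e₀ z) :
    l0 * (l0 - l1) * (ip x e₀ ^ 2 * ip e₀ z) ^ 2 ≤ (l0 * (l0 * ip x x - ip x (K x))) * ip (x - ip x e₀ • e₀) (x - ip x e₀ • e₀) := by
  have h1 := firstMoment_floor ip hip hip0 K hK hn heig hdom hl x z hxz hzz
  have h2 := offSupport_floor ip hip hip0 e₀ x z hxz hzz
  obtain ⟨-, hQ⟩ := probe_nonneg ip hip0 e₀ x z hzz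
  have hP : 0 ≤ l0 * ip x x - ip x (K x) := le_trans (mul_nonneg (sub_nonneg.2 hl) hQ) h1
  have h3 : (l0 - l1) * (ip x e₀ ^ 2 * ip e₀ z) * (ip x e₀ ^ 2 * ip e₀ z) ≤
      (l0 * ip x x - ip x (K x)) * ip (x - ip x e₀ • e₀) (x - ip x e₀ • e₀) := mul_le_mul h1 h2 hQ hP
  have h4 := mul_le_mul_of_nonneg_left h3 hl0
  calc l0 * (l0 - l1) * (ip x e₀ ^ 2 * ip e₀ z) ^ 2 = l0 * ((l0 - l1) * (ip x e₀ ^ 2 * ip e₀ z) * (ip x e₀ ^ 2 * ip e₀ z)) := by ring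
    _ ≤ l0 * ((l0 * ip x x - ip x (K x)) * ip (x - ip x e₀ • e₀) (x - ip x e₀ • e₀)) := h4
    _ = (l0 * (l0 * ip x x - ip x (K x))) * ip (x - ip x e₀ • e₀) (x - ip x e₀ • e₀) := by ring

/-- **Order comparison.**  A floor `D·√μ` beats a linear allowance `Cb·μ` (`D, Cb > 0`) for every `0 < μ < (D/Cb)²`. [folklore] -/
theorem sqrt_floor_exceeds_linear_allowance {D Cb μ : ℝ} (hD : 0 < D) (hCb : 0 < Cb) (hμ : 0 < μ) (hlt : μ < (D / Cb) ^ 2) :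
    Cb * μ < D * Real.sqrt μ := by
  have hs : Real.sqrt μ < D / Cb := by
    have h := Real.sqrt_lt_sqrt hμ.le hlt
    rwa [Real.sqrt_sq (div_pos hD hCb).le] at h
  have hs0 : 0 < Real.sqrt μ := Real.sqrt_pos.2 hμ
  have h1 : Cb * Real.sqrt μ < D := by
    have := (lt_div_iff₀ hCb).1 hs
    linarith [mul_comm (Real.sqrt μ) Cb]
  calc Cb * μ = (Cb * Real.sqrt μ) * Real.sqrt μ := by rw [mul_assoc, Real.mul_self_sqrt hμ.le]
    _ < D * Real.sqrt μ := mul_lt_mul_of_pos_right h1 hs0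

/-- ★ **The proxy route cannot meet an `O(μ)` allowance (gap calibration).**  If the gap is calibrated `γ·μ·λ₀ ≤ λ₀ − λ₁` (`γ, μ, λ₀ > 0`; crux ONE:
`1 − λ₁/λ₀ ≥ 1 − e^{−2μΔ₁ + 4Cμ²}`), the probe mass `Q := a²·ip e₀ z` is positive, and `Mj ≥ 0` is any number with `Mj² ≥ G²·(λ₀P(x))·ip η η` (`G = ‖g‖∞²`;
by `proxy_floor`, `Mj² ≥ G²λ₀(λ₀−λ₁)Q² ≥ G²λ₀²γμQ²`), then `Mj` exceeds the allowance `Cb·μ·λ₀` for every `μ < (G·Q·√γ/Cb)²` — i.e. for all lattice sizes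
`L = Λ/(2μ)` beyond a threshold, at every fixed `Λ`. [folklore] -/
theorem allowance_lt_proxyMajorant {G l0 γ μ Q Cb Mj : ℝ} (hG : 0 < G) (hl0 : 0 < l0) (hγ : 0 < γ) (hμ : 0 < μ) (hQ : 0 < Q) (hCb : 0 < Cb)
    (hMj0 : 0 ≤ Mj) (hMj : G ^ 2 * l0 ^ 2 * γ * μ * Q ^ 2 ≤ Mj ^ 2) (hlt : μ < (G * Q * Real.sqrt γ / Cb) ^ 2) :
    Cb * μ * l0 < Mj := by
  have hD : 0 < G * Q * Real.sqrt γ := by positivity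
  have h1 := sqrt_floor_exceeds_linear_allowance hD hCb hμ hlt
  -- `Mj ≥ G·Q·√γ·√μ·l0`
  have hsq : (G * Q * Real.sqrt γ * Real.sqrt μ * l0) ^ 2 ≤ Mj ^ 2 := by
    have e : (G * Q * Real.sqrt γ * Real.sqrt μ * l0) ^ 2 = G ^ 2 * l0 ^ 2 * γ * μ * Q ^ 2 := by
      rw [show (G * Q * Real.sqrt γ * Real.sqrt μ * l0) ^ 2 = G ^ 2 * Q ^ 2 * Real.sqrt γ ^ 2 * Real.sqrt μ ^ 2 * l0 ^ 2 by ring,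
        Real.sq_sqrt hγ.le, Real.sq_sqrt hμ.le]; ring
    rw [e]; exact hMj
  have h2 : G * Q * Real.sqrt γ * Real.sqrt μ * l0 ≤ Mj := by
    by_contra hcon
    have h3 := mul_self_lt_mul_self hMj0 (lt_of_not_ge hcon)
    nlinarith [h3, hsq]
  calc Cb * μ * l0 < G * Q * Real.sqrt γ * Real.sqrt μ * l0 := by
        have := mul_lt_mul_of_pos_right h1 hl0; linarith [this]
    _ ≤ Mj := h2

end Abstract

/-! ## §2 The physical subspace of the `(ℤ/L)³` model -/

variable {L : ℕ} [NeZero L]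

/-- ★ **Off-support floor for the vacuum defect** (physical subspace, any `L`, any `β`): `x, e₀, z` physical, `⟨x,z⟩ = 0`, `⟨z,z⟩ ≤ ⟨e₀,z⟩`; with `a = ⟨x,e₀⟩`,
`η = x − a·e₀`: `a²·⟨e₀,z⟩ ≤ ‖η‖²`. [folklore] -/
theorem vacuumDefect_floor {x e₀ z : GaugeConfig 3 L SU2 → ℝ} (hx : IsPhys x) (he₀ : IsPhys e₀) (hz : IsPhys z)
    (hxz : l2 x z = 0) (hzz : l2 z z ≤ l2 e₀ z) :
    l2 x e₀ ^ 2 * l2 e₀ z ≤ l2 (x - l2 x e₀ • e₀) (x - l2 x e₀ • e₀) := by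
  have hxz' : l2Form L ⟨x, hx⟩ ⟨z, hz⟩ = 0 := hxz
  have hzz' : l2Form L ⟨z, hz⟩ ⟨z, hz⟩ ≤ l2Form L ⟨e₀, he₀⟩ ⟨z, hz⟩ := hzz
  have h := offSupport_floor (l2Form L) l2Form_symm l2Form_self_nonneg ⟨e₀, he₀⟩ ⟨x, hx⟩ ⟨z, hz⟩ hxz' hzz'
  simpa only [l2Form_apply, Submodule.coe_sub, Submodule.coe_smul] using h

/-- ★ **Off-support floor, multiplier model.**  `ρ` physical with `0 ≤ ρ ≤ 1` and `x = 0` wherever `ρ ≠ 0` (a bump living where the trial state `x` vanishes):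
`a²·∫ρe₀² ≤ ‖η‖²`, `a = ⟨x,e₀⟩`, `η = x − a·e₀`. [folklore] -/
theorem vacuumDefect_floor_mul {x e₀ ρ : GaugeConfig 3 L SU2 → ℝ} (hx : IsPhys x) (he₀ : IsPhys e₀) (hρ : IsPhys ρ)
    (hρ01 : ∀ U, 0 ≤ ρ U ∧ ρ U ≤ 1) (hsupp : ∀ U, ρ U ≠ 0 → x U = 0) :
    l2 x e₀ ^ 2 * l2 e₀ (ρ * e₀) ≤ l2 (x - l2 x e₀ • e₀) (x - l2 x e₀ • e₀) := by
  have hz : IsPhys (ρ * e₀) := OpPlat.isPhys_mul hρ he₀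
  have hxz : l2 x (ρ * e₀) = 0 := by
    unfold l2
    have h0 : (fun U => x U * (ρ * e₀) U) = fun _ => (0:ℝ) := by
      funext U
      by_cases h : ρ U = 0
      · simp only [Pi.mul_apply, h, zero_mul, mul_zero]
      · simp only [hsupp U h, zero_mul]
    rw [h0, integral_zero]
  have hzz : l2 (ρ * e₀) (ρ * e₀) ≤ l2 e₀ (ρ * e₀) := by
    unfold l2
    refine integral_mono (hz.integrable_mul hz) (he₀.integrable_mul hz) fun U => ?_
    obtain ⟨h0, h1⟩ := hρ01 U
    have hρ2 : ρ U * ρ U ≤ ρ U := by nlinarith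
    have he2 : 0 ≤ e₀ U * e₀ U := mul_self_nonneg _
    show (ρ * e₀) U * (ρ * e₀) U ≤ e₀ U * (ρ * e₀) U
    simp only [Pi.mul_apply]
    nlinarith [mul_le_mul_of_nonneg_right hρ2 he2]
  exact vacuumDefect_floor hx he₀ hz hxz hzz

/-- ★★ **First-moment floor for a fixed-radius vacuum trial state** (physical subspace, any `L`, any `β`).  `x, e₀, z` physical, `‖e₀‖ = 1`, `K_βe₀ = λ₀e₀`
(`λ₀ = levelValue su2Rep L β 0`), domination of `e₀^⊥` at `λ₁ ≤ λ₀`, `⟨x,z⟩ = 0`, `⟨z,z⟩ ≤ ⟨e₀,z⟩`: `(λ₀ − λ₁)·⟨x,e₀⟩²·⟨e₀,z⟩ ≤ λ₀‖x‖² − ⟨x,K_βx⟩`.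
In the S-PSCAL″ calibration the right side is the booked-as-`O(μ²)` energy deficit `P(Φ̂₀)` and the left side is `≍ μΔ₁·a₀²·τ₀(4R)·λ₀` — order `μ`.
[cite: ReedSimonIV1978, Thm. XIII.1] -/
theorem vacuumEnergy_floor (β : ℝ) {x e₀ z : GaugeConfig 3 L SU2 → ℝ} (hx : IsPhys x) (he₀ : IsPhys e₀) (hz : IsPhys z) (hn : l2 e₀ e₀ = 1)
    (heig : transferApply β e₀ = levelValue su2Rep L β 0 • e₀) {lam1 : ℝ}
    (hdom : ∀ ψ : GaugeConfig 3 L SU2 → ℝ, IsPhys ψ → l2 ψ e₀ = 0 → qform su2Rep β ψ ψ ≤ lam1 * l2 ψ ψ) (hl : lam1 ≤ levelValue su2Rep L β 0)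
    (hxz : l2 x z = 0) (hzz : l2 z z ≤ l2 e₀ z) :
    (levelValue su2Rep L β 0 - lam1) * (l2 x e₀ ^ 2 * l2 e₀ z) ≤ levelValue su2Rep L β 0 * l2 x x - qform su2Rep β x x := by
  have heig' : transferOp β ⟨e₀, he₀⟩ = levelValue su2Rep L β 0 • (⟨e₀, he₀⟩ : physSubmodule L) :=
    Subtype.ext (by rw [coe_transferOp, Submodule.coe_smul]; exact heig)
  have hn' : l2Form L ⟨e₀, he₀⟩ ⟨e₀, he₀⟩ = 1 := hn
  have hdom' : ∀ y : physSubmodule L, l2Form L y ⟨e₀, he₀⟩ = 0 → l2Form L y (transferOp β y) ≤ lam1 * l2Form L y y := fun y hy => by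
    rw [l2Form_transferOp_right, l2Form_apply]; exact hdom _ (isPhys_coe y) hy
  have hxz' : l2Form L ⟨x, hx⟩ ⟨z, hz⟩ = 0 := hxz
  have hzz' : l2Form L ⟨z, hz⟩ ⟨z, hz⟩ ≤ l2Form L ⟨e₀, he₀⟩ ⟨z, hz⟩ := hzz
  have h := firstMoment_floor (l2Form L) l2Form_symm l2Form_self_nonneg (transferOp β) (transferOp_symm β) hn' heig' hdom' hl
    ⟨x, hx⟩ ⟨z, hz⟩ hxz' hzz'
  simpa only [l2Form_apply, coe_transferOp, PScal.l2_transferApply_eq_qform] using h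

/-- ★ **Proxy floor** (physical subspace, `β ≥ 0`): `λ₀(λ₀ − λ₁)·(⟨x,e₀⟩²⟨e₀,z⟩)² ≤ (λ₀·(λ₀‖x‖² − ⟨x,K_βx⟩))·‖η‖²` — the square of the majorant of
`‖η‖·‖λ₀η − K_βη‖` that `residual_sq_le_phys` yields is bounded below; in the S-PSCAL″ calibration it is `Θ(μ^{1/2})·(λ₀‖Φ̂₀‖²)` squared. [cite: Kato1949, §1] -/
theorem vacuumProxy_floor {β : ℝ} (hβ : 0 ≤ β) {x e₀ z : GaugeConfig 3 L SU2 → ℝ} (hx : IsPhys x) (he₀ : IsPhys e₀) (hz : IsPhys z)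
    (hn : l2 e₀ e₀ = 1) (heig : transferApply β e₀ = levelValue su2Rep L β 0 • e₀) {lam1 : ℝ}
    (hdom : ∀ ψ : GaugeConfig 3 L SU2 → ℝ, IsPhys ψ → l2 ψ e₀ = 0 → qform su2Rep β ψ ψ ≤ lam1 * l2 ψ ψ) (hl : lam1 ≤ levelValue su2Rep L β 0)
    (hxz : l2 x z = 0) (hzz : l2 z z ≤ l2 e₀ z) :
    levelValue su2Rep L β 0 * (levelValue su2Rep L β 0 - lam1) * (l2 x e₀ ^ 2 * l2 e₀ z) ^ 2 ≤
      (levelValue su2Rep L β 0 * (levelValue su2Rep L β 0 * l2 x x - qform su2Rep β x x)) * l2 (x - l2 x e₀ • e₀) (x - l2 x e₀ • e₀) := by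
  have heig' : transferOp β ⟨e₀, he₀⟩ = levelValue su2Rep L β 0 • (⟨e₀, he₀⟩ : physSubmodule L) :=
    Subtype.ext (by rw [coe_transferOp, Submodule.coe_smul]; exact heig)
  have hn' : l2Form L ⟨e₀, he₀⟩ ⟨e₀, he₀⟩ = 1 := hn
  have hdom' : ∀ y : physSubmodule L, l2Form L y ⟨e₀, he₀⟩ = 0 → l2Form L y (transferOp β y) ≤ lam1 * l2Form L y y := fun y hy => by
    rw [l2Form_transferOp_right, l2Form_apply]; exact hdom _ (isPhys_coe y) hy
  have hxz' : l2Form L ⟨x, hx⟩ ⟨z, hz⟩ = 0 := hxz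
  have hzz' : l2Form L ⟨z, hz⟩ ⟨z, hz⟩ ≤ l2Form L ⟨e₀, he₀⟩ ⟨z, hz⟩ := hzz
  have h := proxy_floor (l2Form L) l2Form_symm l2Form_self_nonneg (transferOp β) (transferOp_symm β) hn'
    (levelValue_su2Rep_nonneg L hβ 0) heig' hdom' hl ⟨x, hx⟩ ⟨z, hz⟩ hxz' hzz'
  simpa only [l2Form_apply, Submodule.coe_sub, Submodule.coe_smul, coe_transferOp, PScal.l2_transferApply_eq_qform] using h

/-- ★★ **The residual-free product identity for the TRUE top eigenvector** (any `L`, any `β`): for a bounded measurable gauge- and twist-invariant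
multiplier `g` and a physical `e₀` with `K_βe₀ = λ₀e₀`,
`λ₀‖g e₀‖² − ⟨g e₀, K_β(g e₀)⟩ = ½ ∫∫ e₀(U) K_β(U,V) e₀(V) (g U − g V)² d(μ⊗μ)` — the bracket `λ₀⟨g²e₀,e₀⟩ − ⟨g²e₀,K_βe₀⟩` of `energy_mul_eq_su2` vanishes,
so NO residual `‖(λ₀ − K_β)·‖` enters: the repair (R4) of the fixed-radius vacuum package. [cite: SimonB1983DiscreteSpectrum, §3] [cite: Luscher1983, §3] -/
theorem energy_mul_vacuum_eq (β : ℝ) {g : GaugeConfig 3 L SU2 → ℝ} (hgm : Measurable g) {Cg : ℝ} (hgb : ∀ U, |g U| ≤ Cg)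
    (hgg : ∀ (k : Site 3 L → SU2) (U : GaugeConfig 3 L SU2), g (gaugeTransform k U) = g U)
    (hgz : ∀ (k : Fin 3), ∀ z ∈ Subgroup.center SU2, ∀ U : GaugeConfig 3 L SU2, g (twist k z U) = g U)
    {e₀ : GaugeConfig 3 L SU2 → ℝ} (he₀ : IsPhys e₀) (heig : transferApply β e₀ = levelValue su2Rep L β 0 • e₀) :
    levelValue su2Rep L β 0 * l2 (fun U => g U * e₀ U) (fun U => g U * e₀ U) - qform su2Rep β (fun U => g U * e₀ U) (fun U => g U * e₀ U)
      = (1 / 2) * ∫ p, e₀ p.1 * transferKernel su2Rep β p.1 p.2 * e₀ p.2 * (g p.1 - g p.2) ^ 2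
          ∂(configMeasure SU2 L).prod (configMeasure SU2 L) := by
  have h := energy_mul_eq_su2 β hgm hgb hgg hgz he₀ (levelValue su2Rep L β 0)
  have hs : l2 (fun U => g U ^ 2 * e₀ U) (transferApply β e₀) = levelValue su2Rep L β 0 * l2 (fun U => g U ^ 2 * e₀ U) e₀ := by
    rw [heig, l2_comm, l2_smul_left, l2_comm]
  rw [hs, sub_self, zero_add] at h
  exact h

end Summit.QuantumFields.YangMills.Theorems.FemtoTransferGap.PolyakovLift.Negative

end
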